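import Mathlib.LinearAlgebra.Lagrange
import Mathlib.Analysis.Complex.Basic
import Mathlib.Algebra.Polynomial.AlgebraMap
import HarnessLib

/-!
# A skew operator annihilated by `∏_{k ∈ S} (X − i k)`, `S ⊂ ℤ ∩ [−r, r]`, has `‖D u‖² ≤ r² ‖u‖²` for a Hermitian form

Topic `Analysis/OperatorTheory`; namespace `Literature.Analysis.OperatorTheory`; THEOREMS ONLY (no `def`, no named fact, no instance, no notation, no `sorry`);
Mathlib only.  Cell `hodgecm-mathlib`, F0∕P3, T1a arch line, ROAD-GLOB (A6 #92 at `U(2,1)`), brick «FB», piece **T1** of the torus bound (A-p06 (g24) plan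
2026-08-31T20:50Z): the maximal torus `𝔱 = i·diag` of `K = U(2)×U(1)` acts on the `𝔭`-filtration level `F n` through skew operators killed by
`∏_{|k| ≤ r₀+n} (X − i k)` (T2∕T3); THIS file turns such an annihilating polynomial into the operator bound the factorial estimate (★ G2
`FiltrationFactorialBound`) consumes — with the MAXIMUM of `|k|`, not their sum (contrast ★ `AlgebraicVectorBounds.norm_apply_le_rootSum_of_skew…`,
whose `Λ = Σ |roots|` is quadratic in `r` and useless for analyticity).

THE STATEMENT ([HarishChandra1953, §9]; [Borel1997, Thm. 8.5 (spectral decomposition under a compact torus)]).  `V` a complex vector space with a HERMITIAN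
form `B` (conjugate-linear in the first variable, `B x y = conj (B y x)`, `Re B x x ≥ 0`), `D` a `B`-SKEW operator (`B (D x) y = −B x (D y)`), `S ⊂ ℤ` finite
with `|k| ≤ r` on `S`, and `u` with `(∏_{k∈S} (D − i k)) u = 0` (as `Polynomial.aeval D (Lagrange.nodal S (k ↦ i k)) u = 0`).  Then, with the Lagrange
decomposition `u = Σ_k u_k`, `D u_k = i k · u_k`:
* `form_eq_zero_of_skew_eigen` — `B`-orthogonality of `D`-eigenvectors with distinct imaginary eigenvalues;
* `sum_lagrange_apply_eq`, `apply_lagrange_eq_smul` — the decomposition and the eigen-equations;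
* **`re_form_apply_apply_le_of_skew_of_nodal`** — `Re B (D u) (D u) ≤ r² · Re B u u`;
  and `re_form_self_eq_sum` — `Re B u u = Σ_k Re B u_k u_k` (Pythagoras).
HONEST LABEL: closes no registered stub by itself.  HC_CM is proved only modulo the 2 remaining named inputs (hLiu418, h413) until rung 0 closes.

## References
* Harish-Chandra, *Representations of a semisimple Lie group on a Banach space. I*, Trans. AMS 75 (1953), §9 [HarishChandra1953].
* A. Borel, *Automorphic forms on `SL₂(ℝ)`* (1997), Thm. 8.5 [Borel1997].
-/

set_option autoImplicit false

noncomputable section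

namespace Literature.Analysis.OperatorTheory

open Polynomial Finset
open scoped ComplexConjugate

universe v

variable {V : Type v} [AddCommGroup V] [Module ℂ V]

/-! ## §1 Orthogonality of eigenvectors of a skew operator -/

/-- For a `B`-skew `D` and `D x = (i a) x`, `D y = (i b) y` with real `a ≠ b`: `B x y = 0`. [cite: Borel1997, Theorem 8.5] -/
theorem form_eq_zero_of_skew_eigen (B : V →ₗ⋆[ℂ] V →ₗ[ℂ] ℂ) (D : Module.End ℂ V) (hD : ∀ x y, B (D x) y = -B x (D y))
    {a b : ℝ} (hab : a ≠ b) {x y : V} (hx : D x = ((a : ℂ) * Complex.I) • x) (hy : D y = ((b : ℂ) * Complex.I) • y) : B x y = 0 := by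
  have h := hD x y
  rw [hx, hy, LinearMap.map_smulₛₗ₂, LinearMap.map_smul] at h
  -- `conj (a i) B x y = − (b i) B x y`
  have hconj : (starRingEnd ℂ) ((a : ℂ) * Complex.I) = -((a : ℂ) * Complex.I) := by
    rw [map_mul, Complex.conj_ofReal, Complex.conj_I, mul_neg]
  rw [hconj, smul_eq_mul, smul_eq_mul] at h
  -- `(b − a) i · B x y = 0`
  have h2 : (((b : ℂ) - a) * Complex.I) * B x y = 0 := by linear_combination h
  rcases mul_eq_zero.mp h2 with h3 | h3
  · exfalso
    rcases mul_eq_zero.mp h3 with h4 | h4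
    · exact hab (by exact_mod_cast (sub_eq_zero.mp h4).symm)
    · exact Complex.I_ne_zero h4
  · exact h3

/-! ## §2 The Lagrange decomposition along `∏_{k∈S} (X − i k)` -/

section Lagrange

variable (D : Module.End ℂ V) (S : Finset ℤ)

/-- The nodes `k ↦ i k` are injective on `S`. [cite: Borel1997, Theorem 8.5] -/
theorem injOn_intCast_mul_I : Set.InjOn (fun k : ℤ => (k : ℂ) * Complex.I) (S : Set ℤ) := by
  intro a _ b _ h
  have h' := mul_right_cancel₀ Complex.I_ne_zero h
  exact_mod_cast h'

/-- `u = Σ_{k∈S} L_k(D) u` for the Lagrange basis `L_k` at the nodes `i k` (`Σ L_k = 1`), `S ≠ ∅`. [cite: Borel1997, Theorem 8.5] -/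
theorem sum_lagrange_apply_eq (hS : S.Nonempty) (u : V) :
    ∑ k ∈ S, aeval D (Lagrange.basis S (fun k : ℤ => (k : ℂ) * Complex.I) k) u = u := by
  rw [← LinearMap.sum_apply, ← map_sum, Lagrange.sum_basis (injOn_intCast_mul_I S) hS, map_one, Module.End.one_apply]

/-- Each Lagrange component is a `D`-eigenvector: `D (L_k(D) u) = (i k) · L_k(D) u` when `(∏_{l∈S} (D − i l)) u = 0`. [cite: Borel1997, Theorem 8.5] -/
theorem apply_lagrange_eq_smul {u : V} (hu : aeval D (Lagrange.nodal S fun k : ℤ => (k : ℂ) * Complex.I) u = 0) {k : ℤ} (hk : k ∈ S) :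
    D (aeval D (Lagrange.basis S (fun k : ℤ => (k : ℂ) * Complex.I) k) u) =
      ((k : ℂ) * Complex.I) • aeval D (Lagrange.basis S (fun k : ℤ => (k : ℂ) * Complex.I) k) u := by
  classical
  set v : ℤ → ℂ := fun k => (k : ℂ) * Complex.I with hv
  -- `(X − C (v k)) * L_k = C w * nodal S v`
  have hfac : (X - Polynomial.C (v k)) * Lagrange.basis S v k = Polynomial.C (Lagrange.nodalWeight S v k) * Lagrange.nodal S v := by
    rw [Lagrange.basis_eq_prod_sub_inv_mul_nodal_div hk, ← Lagrange.nodal_erase_eq_nodal_div hk, mul_left_comm,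
      ← Lagrange.nodal_eq_mul_nodal_erase hk]
  -- apply `aeval D` to `u`
  have h1 : aeval D ((X - Polynomial.C (v k)) * Lagrange.basis S v k) u = 0 := by
    rw [hfac, map_mul, Module.End.mul_apply, hu, map_zero]
  rw [map_mul, Module.End.mul_apply, map_sub, aeval_X, aeval_C, LinearMap.sub_apply, sub_eq_zero, Module.algebraMap_end_apply] at h1
  exact h1

end Lagrange

/-! ## §3 The bound `Re B (D u) (D u) ≤ r² Re B u u` -/

/-- Pythagoras for a `B`-orthogonal family: `B (Σ x_k) (Σ x_k) = Σ B x_k x_k`. [cite: Borel1997, Theorem 8.5] -/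
theorem form_sum_sum_eq_of_pairwise (B : V →ₗ⋆[ℂ] V →ₗ[ℂ] ℂ) (S : Finset ℤ) (x : ℤ → V)
    (horth : ∀ k ∈ S, ∀ l ∈ S, k ≠ l → B (x k) (x l) = 0) :
    B (∑ k ∈ S, x k) (∑ l ∈ S, x l) = ∑ k ∈ S, B (x k) (x k) := by
  rw [LinearMap.map_sum₂, ]
  refine Finset.sum_congr rfl fun k hk => ?_
  rw [map_sum]
  exact Finset.sum_eq_single_of_mem k hk fun l hl hlk => horth k hk l hl (Ne.symm hlk)

/-- **T1 — SKEW INTEGER SPECTRUM BOUND.**  `B` Hermitian with `Re B x x ≥ 0`, `D` `B`-skew, `(∏_{k∈S} (D − i k)) u = 0` with `S ⊂ ℤ`, `|k| ≤ r` on `S`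
⇒ `Re B (D u) (D u) ≤ r² · Re B u u`. [cite: HarishChandra1953, §9] [cite: Borel1997, Theorem 8.5] -/
theorem re_form_apply_apply_le_of_skew_of_nodal (B : V →ₗ⋆[ℂ] V →ₗ[ℂ] ℂ) (hpos : ∀ x, 0 ≤ (B x x).re)
    (D : Module.End ℂ V) (hD : ∀ x y, B (D x) y = -B x (D y)) (S : Finset ℤ) (r : ℕ) (hSr : ∀ k ∈ S, |k| ≤ r) {u : V}
    (hu : aeval D (Lagrange.nodal S fun k : ℤ => (k : ℂ) * Complex.I) u = 0) :
    (B (D u) (D u)).re ≤ (r : ℝ) ^ 2 * (B u u).re := by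
  classical
  rcases S.eq_empty_or_nonempty with hS | hS
  · -- `S = ∅`: the annihilator is `1`, so `u = 0`
    subst hS
    rw [Lagrange.nodal_empty, map_one, Module.End.one_apply] at hu
    subst hu
    simp
  set x : ℤ → V := fun k => aeval D (Lagrange.basis S (fun k : ℤ => (k : ℂ) * Complex.I) k) u with hx
  have hsum : ∑ k ∈ S, x k = u := sum_lagrange_apply_eq D S hS u
  have heig : ∀ k ∈ S, D (x k) = ((k : ℂ) * Complex.I) • x k := fun k hk => apply_lagrange_eq_smul D S hu hk
  have horth : ∀ k ∈ S, ∀ l ∈ S, k ≠ l → B (x k) (x l) = 0 := by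
    intro k hk l hl hkl
    have hk' : D (x k) = (((k : ℝ) : ℂ) * Complex.I) • x k := by rw [heig k hk]; norm_cast
    have hl' : D (x l) = (((l : ℝ) : ℂ) * Complex.I) • x l := by rw [heig l hl]; norm_cast
    exact form_eq_zero_of_skew_eigen B D hD (by exact_mod_cast hkl) hk' hl'
  -- `D u = Σ (i k) • x k`, and these are still pairwise orthogonal
  have hDu : D u = ∑ k ∈ S, ((k : ℂ) * Complex.I) • x k := by
    rw [← hsum, map_sum]
    exact Finset.sum_congr rfl fun k hk => heig k hk
  have horth' : ∀ k ∈ S, ∀ l ∈ S, k ≠ l → B (((k : ℂ) * Complex.I) • x k) (((l : ℂ) * Complex.I) • x l) = 0 := by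
    intro k hk l hl hkl
    rw [LinearMap.map_smulₛₗ₂, LinearMap.map_smul, horth k hk l hl hkl, smul_zero, smul_zero]
  have h1 : B (D u) (D u) = ∑ k ∈ S, B (((k : ℂ) * Complex.I) • x k) (((k : ℂ) * Complex.I) • x k) := by
    rw [hDu]; exact form_sum_sum_eq_of_pairwise B S _ horth'
  have h2 : B u u = ∑ k ∈ S, B (x k) (x k) := by
    conv_lhs => rw [← hsum]
    exact form_sum_sum_eq_of_pairwise B S x horth
  -- termwise: `B ((ik) x) ((ik) x) = k² B x x` and `k² ≤ r²`
  have hterm : ∀ k ∈ S, (B (((k : ℂ) * Complex.I) • x k) (((k : ℂ) * Complex.I) • x k)).re ≤ (r : ℝ) ^ 2 * (B (x k) (x k)).re := by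
    intro k hk
    rw [LinearMap.map_smulₛₗ₂, LinearMap.map_smul, smul_eq_mul, smul_eq_mul]
    have hc : (starRingEnd ℂ) ((k : ℂ) * Complex.I) * (((k : ℂ) * Complex.I) * B (x k) (x k)) = ((k : ℂ) ^ 2) * B (x k) (x k) := by
      rw [map_mul, Complex.conj_I, ← mul_assoc]
      have : (starRingEnd ℂ) (k : ℂ) = k := by exact_mod_cast Complex.conj_ofReal (k : ℝ)
      rw [this]; ring_nf; rw [Complex.I_sq]; ring
    rw [hc]
    have hre : (((k : ℂ) ^ 2) * B (x k) (x k)).re = ((k : ℝ) ^ 2) * (B (x k) (x k)).re := by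
      have : ((k : ℂ) ^ 2) = (((k : ℝ) ^ 2 : ℝ) : ℂ) := by push_cast; ring
      rw [this, Complex.re_ofReal_mul]
    rw [hre]
    have hk2 : ((k : ℝ)) ^ 2 ≤ (r : ℝ) ^ 2 := by
      have habs : |(k : ℝ)| ≤ (r : ℝ) := by exact_mod_cast hSr k hk
      calc ((k : ℝ)) ^ 2 = |(k : ℝ)| ^ 2 := (sq_abs _).symm
        _ ≤ (r : ℝ) ^ 2 := pow_le_pow_left₀ (abs_nonneg _) habs 2
    exact mul_le_mul_of_nonneg_right hk2 (hpos _)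
  rw [h1, h2, Complex.re_sum, Complex.re_sum, Finset.mul_sum]
  exact Finset.sum_le_sum hterm

end Literature.Analysis.OperatorTheory

end
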